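import Literature.Probability.Percolation.TrapPairSetting
import Literature.Probability.Percolation.ArmSeparationRotate
import HarnessLib

/-!
# Reading an actual arm in the rotation frame of the side of its end

Topic `Literature/Probability/Percolation`; family `crit-perc` / near-critical percolation on `𝕋`.
A brick of the near-critical arm-separation theorem for four arms in the ADJACENT colour
arrangement (P. Nolin, EJP 13 (2008), Thm. 11, `j = 4`, `σ = BBWW` [arXiv 0711.4948: Thm. 10],
§4.4, first step: the arms are read behind the side of `∂Λ_{2M}` on which they end): an actual
self-avoiding walk of `{n ≤ |v| ≤ 2M}` from `∂Λ_n` to the point `ρ^i (2M, t)` of the side `i` of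
`∂Λ_{2M}`, using only sites of `χ` and meeting `∂Λ_{2M}` only at its end, is carried by `ρ^{6-i}` to
a walk of the frame of the side `i`: it ends at `(2M, t) ∈ trapO M`, its sites lie in
`{n ≤ |v| ≤ 2M} ∩ rotConfig i χ`, it is clean at `∂Λ_{2M}` and still a path (`frameWalk`,
`frameWalk_facts`). Two frames see the same actual walk (`mem_support_frameWalk_iff`). These are the
fields `A`, `supp`, `y_mem`, `clean` of the pair structures `PairData` / `PairDataB` and the
correspondences `arm0`/`arm1` of `CrossData`.

Everything here is proved; no named facts are introduced.

## References

* P. Nolin, Near-critical percolation in two dimensions, *Electron. J. Probab.* 13 (2008), §4.4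
  (arXiv 0711.4948: proof of Thm. 10, first step; U-shaped regions) [Nolin2008].
-/

noncomputable section

open Set

namespace Literature.Probability.Percolation

open LatticeModels SimpleGraph

/-- **The frame reading of a walk**: the image under `ρ^{6-i}` (the inverse of the frame rotation `ρ^i`). [folklore] -/
def frameWalk (i : ℕ) {x y : Site 2} (W : triGraph.Walk x y) :
    triGraph.Walk (triRotIsoPow (6 - i) x) (triRotIsoPow (6 - i) y) :=
  W.map (triRotIsoPow (6 - i)).toEmbedding.toHom

/-- Sites of the frame reading. [folklore] -/
theorem mem_support_frameWalk {i : ℕ} {x y : Site 2} {W : triGraph.Walk x y} {v : Site 2} :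
    v ∈ (frameWalk i W).support ↔ ∃ u ∈ W.support, triRotIsoPow (6 - i) u = v := by
  unfold frameWalk; rw [Walk.support_map, List.mem_map]; rfl

/-- Reading back: a frame site `v` of the frame reading is `ρ^{6-i} u` for the actual site `u = ρ^i v` (`i ≤ 6`). [folklore] -/
theorem mem_support_frameWalk_iff {i : ℕ} (hi : i ≤ 6) {x y : Site 2} {W : triGraph.Walk x y} {v : Site 2} :
    v ∈ (frameWalk i W).support ↔ triRotIsoPow i v ∈ W.support := by
  rw [mem_support_frameWalk]
  constructor
  · rintro ⟨u, hu, rfl⟩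
    rw [← triRotIsoPow_add_apply, show 6 - i + i = 6 by omega, triRotIsoPow_six_apply]; exact hu
  · intro h
    exact ⟨_, h, by rw [← triRotIsoPow_add_apply, show i + (6 - i) = 6 by omega, triRotIsoPow_six_apply]⟩

/-- The frame reading of a path is a path. [folklore] -/
theorem frameWalk_isPath {i : ℕ} {x y : Site 2} {W : triGraph.Walk x y} (hW : W.IsPath) : (frameWalk i W).IsPath :=
  hW.map (triRotIsoPow (6 - i)).injective

/-- **Facts of the frame reading** of an actual walk of the annulus `{n ≤ |v| ≤ 2M}` using sites
of `χ`, meeting `∂Λ_{2M}` only at its end `ρ^i (2M, t)` (`-2M ≤ t ≤ 0`, `i < 6`): the end is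
`(2M, t) ∈ trapO M`, the sites lie in the annulus and are open in `rotConfig i χ`, the reading is
clean at `∂Λ_{2M}`, and norms are kept. [cite: Nolin2008, §4.4 (arXiv 0711.4948: proof of Thm. 10, first step)] -/
theorem frameWalk_facts {M n i : ℕ} (hi : i < 6) (hM : 1 ≤ M) {χ : SiteConfig (Site 2)} {x y : Site 2} (W : triGraph.Walk x y)
    (hsupp : ∀ v ∈ W.support, (n : ℤ) ≤ triNorm v ∧ triNorm v ≤ 2 * M) (hopen : ∀ v ∈ W.support, v ∈ χ)
    (hclean : ∀ v ∈ W.support, triNorm v = 2 * M → v = y) {t : ℤ} (ht : -(2 * (M : ℤ)) ≤ t ∧ t ≤ 0)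
    (hy : y = triRotIsoPow i ![2 * (M : ℤ), t]) :
    triRotIsoPow (6 - i) y = ![2 * (M : ℤ), t] ∧ (![2 * (M : ℤ), t] : Site 2) ∈ trapO M ∧
      (∀ v ∈ (frameWalk i W).support, v ∈ triAnnSet n (2 * M) ∩ (rotConfig i χ : Set (Site 2))) ∧
      (∀ v ∈ (frameWalk i W).support, triNorm v = 2 * M → v = triRotIsoPow (6 - i) y) ∧
      triNorm (triRotIsoPow (6 - i) x) = triNorm x := by
  have hyy : triRotIsoPow (6 - i) y = ![2 * (M : ℤ), t] := by
    rw [hy, ← triRotIsoPow_add_apply, show i + (6 - i) = 6 by omega, triRotIsoPow_six_apply]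
  refine ⟨hyy, ?_, fun v hv => ?_, fun v hv hvn => ?_, triNorm_rot _ _⟩
  · have e0 : (![2 * (M : ℤ), t] : Site 2) 0 = 2 * M := rfl
    have e1 : (![2 * (M : ℤ), t] : Site 2) 1 = t := rfl
    rw [mem_trapO, mem_trapD, e0, e1]
    omega
  · obtain ⟨u, hu, rfl⟩ := mem_support_frameWalk.1 hv
    refine ⟨?_, ?_⟩
    · rw [mem_triAnnSet, triNorm_rot]; exact hsupp u hu
    · show triRotIsoPow (6 - i) u ∈ rotConfig i χ
      rw [mem_rotConfig, ← triRotIsoPow_add_apply, show 6 - i + i = 6 by omega, triRotIsoPow_six_apply]; exact hopen u hu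
  · obtain ⟨u, hu, rfl⟩ := mem_support_frameWalk.1 hv
    rw [triNorm_rot] at hvn
    rw [hclean u hu hvn]

/-- **Two frame readings of disjoint actual walks are disjoint**, and one frame reading of two
disjoint walks too. [folklore] -/
theorem frameWalk_disjoint {i : ℕ} {x y x' y' : Site 2} {W : triGraph.Walk x y} {W' : triGraph.Walk x' y'}
    (h : ∀ v ∈ W.support, v ∉ W'.support) : ∀ v ∈ (frameWalk i W).support, v ∉ (frameWalk i W').support := by
  intro v hv hv'
  obtain ⟨u, hu, rfl⟩ := mem_support_frameWalk.1 hv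
  obtain ⟨u', hu', he⟩ := mem_support_frameWalk.1 hv'
  have e : u' = u := (triRotIsoPow (6 - i)).injective he
  exact h u hu (e ▸ hu')

end Literature.Probability.Percolation
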